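import Mathlib
import HarnessLib

/-!
# PF persistence — the BOX–VERTEX LEMMA for coordinatewise-affine functions (F7 corner reduction)
(pub-rhpf barrier-typer gen 5; typing request of fake-7b 14:06Z, HOME/pub-rhpf-fake-7b/CERTIFICATE-F7.md §3a)

**HONEST FRAMING. This is a long-odds MECHANISM SEARCH; no RH claims.** This file has no RH content and no engine
content: it is the one non-numerical input of the cell's ARITH-RIGID certificate rows — a function of `m` real
parameters that is AFFINE IN EACH COORDINATE SEPARATELY and non-negative at the `2^m` vertices of a box is
non-negative on the whole box — together with its matrix-pencil corollaries (the quadratic forms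
`g ↦ gᵀ(Q₀ + Σ_j t_j V_j)g`, and the shifted forms `gᵀQ(t)g − c·gᵀg`, i.e. "`λ_min ≥ c` at the vertices ⇒ on the box").

* `CoordAffine f` — `f : (Fin m → ℝ) → ℝ` is affine along every coordinate line.
* `boxVertex l u ε` — the vertex of the box `[l, u]` selected by `ε : Fin m → Bool`.
* `affine_nonneg_between` — one variable: affine, `≥ 0` at both endpoints ⇒ `≥ 0` between.
* `box_nonneg_of_vertices` — THE LEMMA (induction on the finite set of coordinates not pinned to a vertex value).
* `matrixPencil`, `coordAffine_pencil_form`, `pencil_form_nonneg_of_vertices`, `pencil_form_ge_of_vertices` — the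
  corollaries for symmetric-or-not matrix pencils (no symmetry is needed for the form statements).
-/

set_option linter.dupNamespace false

namespace Summit.RiemannHypothesis.RiemannHypothesis.Theorems.PfPersistence

open Finset Matrix

/-- `f : (Fin m → ℝ) → ℝ` is AFFINE IN EACH COORDINATE SEPARATELY: along every coordinate line through every point
it is of the form `s ↦ α + β s`. -/
def CoordAffine {m : ℕ} (f : (Fin m → ℝ) → ℝ) : Prop :=
  ∀ (j : Fin m) (t : Fin m → ℝ), ∃ α β : ℝ, ∀ s : ℝ, f (Function.update t j s) = α + β * s

/-- The vertex of the box `∏ [l j, u j]` selected by `ε` (`u j` where `ε j = true`, else `l j`). -/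
def boxVertex {m : ℕ} (l u : Fin m → ℝ) (ε : Fin m → Bool) : Fin m → ℝ :=
  fun j => if ε j then u j else l j

/-- PROVED (one variable): an affine function non-negative at `l` and at `u` is non-negative on `[l, u]`. [folklore] -/
theorem affine_nonneg_between {α β l u s : ℝ} (hl : 0 ≤ α + β * l) (hu : 0 ≤ α + β * u) (hls : l ≤ s)
    (hsu : s ≤ u) : 0 ≤ α + β * s := by
  rcases eq_or_lt_of_le (hls.trans hsu) with h | h
  · have hs : s = l := le_antisymm (h ▸ hsu) hls
    rw [hs]
    exact hl
  · have key : (u - l) * (α + β * s) = (u - s) * (α + β * l) + (s - l) * (α + β * u) := by ring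
    have hnn : 0 ≤ (u - s) * (α + β * l) + (s - l) * (α + β * u) :=
      add_nonneg (mul_nonneg (by linarith) hl) (mul_nonneg (by linarith) hu)
    nlinarith

/-- **PROVED — THE BOX–VERTEX LEMMA:** a coordinatewise-affine `f` that is `≥ 0` at every vertex of the box
`[l, u]` is `≥ 0` at every point of the box. (Induction on the set of coordinates not pinned to a vertex value:
freeing one more coordinate `j`, the restriction `s ↦ f(t with t_j := s)` is affine and `≥ 0` at `s = l j, u j` by the
induction hypothesis.) [folklore] -/
theorem box_nonneg_of_vertices {m : ℕ} {f : (Fin m → ℝ) → ℝ} (hf : CoordAffine f) {l u : Fin m → ℝ}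
    (hv : ∀ ε : Fin m → Bool, 0 ≤ f (boxVertex l u ε)) (t : Fin m → ℝ) (ht : ∀ j, l j ≤ t j ∧ t j ≤ u j) :
    0 ≤ f t := by
  suffices h : ∀ (S : Finset (Fin m)) (t : Fin m → ℝ), (∀ j, l j ≤ t j ∧ t j ≤ u j) →
      (∀ j, j ∉ S → t j = l j ∨ t j = u j) → 0 ≤ f t from
    h Finset.univ t ht fun j hj => absurd (Finset.mem_univ j) hj
  intro S
  induction S using Finset.induction_on with
  | empty =>
    intro t ht hvert
    have heq : t = boxVertex l u (fun j => decide (t j = u j)) := by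
      funext j
      simp only [boxVertex]
      by_cases hju : t j = u j
      · simp [hju]
      · rcases hvert j (by simp) with h | h
        · simp [h]
        · exact absurd h hju
    rw [heq]
    exact hv _
  | insert j S hjS ih =>
    intro t ht hvert
    obtain ⟨α, β, hαβ⟩ := hf j t
    have hbox : ∀ s : ℝ, l j ≤ s → s ≤ u j → ∀ i, l i ≤ Function.update t j s i ∧ Function.update t j s i ≤ u i := by
      intro s hs1 hs2 i
      by_cases hij : i = j
      · subst hij
        simpa using And.intro hs1 hs2
      · rw [Function.update_of_ne hij]
        exact ht i
    have hpin : ∀ s : ℝ, (s = l j ∨ s = u j) →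
        ∀ i, i ∉ S → Function.update t j s i = l i ∨ Function.update t j s i = u i := by
      intro s hs i hi
      by_cases hij : i = j
      · subst hij
        simpa using hs
      · rw [Function.update_of_ne hij]
        exact hvert i (by simp [Finset.mem_insert, hij, hi])
    have hlu : l j ≤ u j := (ht j).1.trans (ht j).2
    have hlo : 0 ≤ α + β * l j := by
      rw [← hαβ]
      exact ih _ (hbox (l j) le_rfl hlu) (hpin (l j) (Or.inl rfl))
    have hup : 0 ≤ α + β * u j := by
      rw [← hαβ]
      exact ih _ (hbox (u j) hlu le_rfl) (hpin (u j) (Or.inr rfl))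
    have := affine_nonneg_between hlo hup (ht j).1 (ht j).2
    rwa [← hαβ, Function.update_eq_self] at this

/-! ## Matrix pencils -/

/-- The affine matrix pencil `Q(t) = Q₀ + Σ_j t_j • V_j`. -/
def matrixPencil {n m : ℕ} (Q₀ : Matrix (Fin n) (Fin n) ℝ) (V : Fin m → Matrix (Fin n) (Fin n) ℝ)
    (t : Fin m → ℝ) : Matrix (Fin n) (Fin n) ℝ :=
  Q₀ + ∑ j, t j • V j

/-- PROVED: for every vector `g`, the form `t ↦ gᵀ Q(t) g` of a matrix pencil is coordinatewise affine
(slope `gᵀ V_j g` along coordinate `j`). [folklore] -/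
theorem coordAffine_pencil_form {n m : ℕ} (Q₀ : Matrix (Fin n) (Fin n) ℝ) (V : Fin m → Matrix (Fin n) (Fin n) ℝ)
    (g : Fin n → ℝ) : CoordAffine fun t => g ⬝ᵥ (matrixPencil Q₀ V t *ᵥ g) := by
  intro j t
  refine ⟨g ⬝ᵥ ((Q₀ + ∑ i ∈ Finset.univ.erase j, t i • V i) *ᵥ g), g ⬝ᵥ (V j *ᵥ g), fun s => ?_⟩
  have hsum : ∑ i, Function.update t j s i • V i = s • V j + ∑ i ∈ Finset.univ.erase j, t i • V i := by
    rw [← Finset.add_sum_erase _ _ (Finset.mem_univ j)]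
    congr 1
    · simp
    · refine Finset.sum_congr rfl fun i hi => ?_
      rw [Function.update_of_ne (Finset.ne_of_mem_erase hi)]
  simp only [matrixPencil, hsum, Matrix.add_mulVec, dotProduct_add, Matrix.smul_mulVec, dotProduct_smul,
    smul_eq_mul]
  ring

/-- **PROVED — PENCIL COROLLARY (forms):** if `gᵀ Q(v) g ≥ 0` for every `g` at every VERTEX `v` of the box, then
`gᵀ Q(t) g ≥ 0` for every `g` at every point `t` of the box (no symmetry assumption needed). [folklore] -/
theorem pencil_form_nonneg_of_vertices {n m : ℕ} (Q₀ : Matrix (Fin n) (Fin n) ℝ)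
    (V : Fin m → Matrix (Fin n) (Fin n) ℝ) {l u : Fin m → ℝ}
    (hv : ∀ (ε : Fin m → Bool) (g : Fin n → ℝ), 0 ≤ g ⬝ᵥ (matrixPencil Q₀ V (boxVertex l u ε) *ᵥ g))
    (t : Fin m → ℝ) (ht : ∀ j, l j ≤ t j ∧ t j ≤ u j) (g : Fin n → ℝ) :
    0 ≤ g ⬝ᵥ (matrixPencil Q₀ V t *ᵥ g) :=
  box_nonneg_of_vertices (coordAffine_pencil_form Q₀ V g) (fun ε => hv ε g) t ht

/-- **PROVED — SHIFTED PENCIL COROLLARY ("`λ_min ≥ c` at the vertices ⇒ on the box", in form language):** if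
`c·gᵀg ≤ gᵀ Q(v) g` for every `g` at every vertex `v`, then `c·gᵀg ≤ gᵀ Q(t) g` on the whole box. [folklore] -/
theorem pencil_form_ge_of_vertices {n m : ℕ} (Q₀ : Matrix (Fin n) (Fin n) ℝ)
    (V : Fin m → Matrix (Fin n) (Fin n) ℝ) {l u : Fin m → ℝ} (c : ℝ)
    (hv : ∀ (ε : Fin m → Bool) (g : Fin n → ℝ), c * (g ⬝ᵥ g) ≤ g ⬝ᵥ (matrixPencil Q₀ V (boxVertex l u ε) *ᵥ g))
    (t : Fin m → ℝ) (ht : ∀ j, l j ≤ t j ∧ t j ≤ u j) (g : Fin n → ℝ) :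
    c * (g ⬝ᵥ g) ≤ g ⬝ᵥ (matrixPencil Q₀ V t *ᵥ g) := by
  have haff : CoordAffine fun t => g ⬝ᵥ (matrixPencil Q₀ V t *ᵥ g) - c * (g ⬝ᵥ g) := by
    intro j t
    obtain ⟨α, β, h⟩ := coordAffine_pencil_form Q₀ V g j t
    exact ⟨α - c * (g ⬝ᵥ g), β, fun s => by simp only [h]; ring⟩
  have := box_nonneg_of_vertices haff (fun ε => sub_nonneg.2 (hv ε g)) t ht
  exact sub_nonneg.1 this

end Summit.RiemannHypothesis.RiemannHypothesis.Theorems.PfPersistence
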